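import Summits.ResolutionOfSingularities.ResolutionOfSingularities.Theorems.FrobeniusClosingSteerCore4IsoChartStepLift
import Summits.ResolutionOfSingularities.ResolutionOfSingularities.Theorems.FrobeniusClosingSteerCore4IsoChartStepPoint
import Mathlib.RingTheory.MvPowerSeries.NoZeroDivisors
import Mathlib.RingTheory.LocalRing.ResidueField.Basic
import HarnessLib

/-!
# Crux `Steer` (stmt-16345), chain W4.1 — dictionary piece T2 `chart_step`, file 3/5: CONSTRUCTION of the
# chart of the quadratic transform (transition law, `φ₁ x = X_j · unit`, constant coefficients = residues)

OURS (campaign `res-hironaka`, rung L, slot W4.1; helper toward the registered stub `stub_core4Iso` of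
reshape r8 of line `switching_dichotomy`, lead res-L0-w41-lead-1's `DICT-SIGS.lean` piece T2 = seam T2b;
replaces the role of no printed item; NOT a statement of the manuscript under review; AI-produced).
Theses-free (imports the two sibling helper files + Mathlib only; chain build rule).

`exists_chart_locAtCentre` (**T2b**): let `φ : R → κ⟦X_1..X_d⟧` be a formal chart of the local subring
`R ⊆ O` dominated by `O` (FC1: constant coefficients are residues through `ι : κ(O) → κ`; FC2: the centre
generates `(X)`; generators `u` of the centre), and `x ∈ R` an exceptional parameter (`v x < 1`,
`R[𝔪_R/x] ⊆ O`). Then, with `ξ ∈ κ^d` the point of T2a (`ChartStepPoint`), `j` an index with `ξ_j ≠ 0`,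
`τ := ξ/ξ_j` and `Φ_{j,τ}` the typed blow-up substitution, there are a UNIT `w` with `Φ_{j,τ}(φ x) = X_j·w`
and a ring map `φ₁ : (R[𝔪_R/x])_{𝔪_O ∩ R[𝔪_R/x]} → κ⟦X⟧` (universal property of the chart + localisation,
`ChartStepLift`) such that `φ₁|_R = Φ_{j,τ} ∘ φ` (TRANSITION LAW — the typed `step` before cleaning),
`constantCoeff ∘ φ₁ = ι ∘ res` (FC1 propagates: on `y/x` because the constant term of the strict transform
`W_y` is `res(y/x)/ξ_j`), and `φ₁(y/x) · X_j w = Φ_{j,τ}(φ y)` for `y` in the centre. FC2 for `φ₁` (the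
separability argument) and the assembled `chart_step` are files 4/5 and 5/5.

Sources: standard (point blow-up of a regular local ring read in formal coordinates; H. Hauser,
S. Perlega, arXiv:1802.05010 §3 for the coordinate form of the transformation rules); folklore. No
definitions.
-/

-- layout-mandated namespace `Summit.<Summit>.<Problem>.…` with Summit = Problem (single-conjunct summit)
set_option linter.dupNamespace false

open IsLocalRing MvPowerSeries
open Literature.AlgebraicGeometry.Resolution

namespace Summit.ResolutionOfSingularities.ResolutionOfSingularities.Theorems.SwitchingDichotomy

namespace ChartStep

section Construct

variable {K : Type*} [Field K] (O : ValuationSubring K) {κ : Type*} [Field κ]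
  (ι : IsLocalRing.ResidueField O →+* κ) {R : Subring K} (hR : R ≤ O.toSubring) [IsLocalRing R]
  (hdom : ∀ a : R, a ∈ maximalIdeal R ↔ O.valuation (a : K) < 1)
  {d : ℕ} (φ : R →+* MvPowerSeries (Fin d) κ)
  (h1 : ∀ r : R, constantCoeff (φ r) = ι (IsLocalRing.residue O (Subring.inclusion hR r)))
  (h2 : Ideal.map φ (Ideal.comap (Subring.inclusion hR) (maximalIdeal O)) =
    Ideal.span (Set.range (X : Fin d → MvPowerSeries (Fin d) κ)))
  (u : Fin d → R) (hu : Ideal.span (Set.range u) = Ideal.comap (Subring.inclusion hR) (maximalIdeal O))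
  {x : K} (hxR : x ∈ R) (hx0 : x ≠ 0) (hxv : O.valuation x < 1)
  (hB : blowupRing R x ≤ O.toSubring)

include hdom in
/-- Under domination the maximal ideal of `R` is the centre of `O`. [folklore] -/
theorem maximalIdeal_eq_centre : maximalIdeal R = Ideal.comap (Subring.inclusion hR) (maximalIdeal O) := by
  ext a
  rw [hdom a]
  exact (mem_subringCentre_iff hR a).symm

include hdom hxv in
/-- `x ∈ 𝔪_R`. [folklore] -/
theorem x_mem_maximalIdeal : (⟨x, hxR⟩ : R) ∈ maximalIdeal R := (hdom _).mpr hxv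

include hdom in
/-- `y / x ∈ R[𝔪_R/x]` for `y` in the centre. [folklore] -/
theorem div_mem_blowupRing_of_mem_centre {y : R}
    (hy : y ∈ Ideal.comap (Subring.inclusion hR) (maximalIdeal O)) : (y : K) / x ∈ blowupRing R x :=
  div_mem_blowupRing x ((maximalIdeal_eq_centre O hR hdom).symm ▸ hy)


include hdom hxv hx0 hB h1 h2 hu in
/-- **T2b — the chart of the quadratic transform, constructed.** From a formal chart `φ` of `R` (FC1/FC2,
generators `u` of the centre) and an exceptional parameter `x` (so that `R[𝔪_R/x] ⊆ O`): the point `ξ` of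
T2a, a chart index `j` with `ξ_j ≠ 0`, the translation `τ = ξ/ξ_j`, a unit `w` with `Φ_{j,τ}(φ x) = X_j·w`,
and a ring map `φ₁ : (R[𝔪_R/x])_{𝔪_O ∩ R[𝔪_R/x]} → κ⟦X⟧` with: transition law `φ₁|_R = Φ_{j,τ} ∘ φ`,
constant coefficients = residues (FC1), and `φ₁(y/x) · X_j w = Φ_{j,τ}(φ y)` for `y` in the centre.
[folklore] -/
theorem exists_chart_locAtCentre :
    ∃ (ξ : Fin d → κ) (j : Fin d) (w : MvPowerSeries (Fin d) κ)
      (φ₁ : locAtCentre (blowupRing R x) O →+* MvPowerSeries (Fin d) κ),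
      ξ j ≠ 0 ∧ IsUnit w ∧
      (∀ (y : R) (_ : y ∈ Ideal.comap (Subring.inclusion hR) (maximalIdeal O)) (hyO : (y : K) / x ∈ O),
          ∑ l, coeff (Finsupp.single l 1) (φ y) * ξ l = ι (IsLocalRing.residue O ⟨(y : K) / x, hyO⟩)) ∧
      subst (fun s : Fin d => if s = j then (X j : MvPowerSeries (Fin d) κ) else X j * (X s + C (ξ s / ξ j)))
          (φ ⟨x, hxR⟩) = X j * w ∧
      (∀ (r : R) (hr : (r : K) ∈ locAtCentre (blowupRing R x) O),
          φ₁ ⟨r, hr⟩ = subst (fun s : Fin d => if s = j then (X j : MvPowerSeries (Fin d) κ)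
            else X j * (X s + C (ξ s / ξ j))) (φ r)) ∧
      (∀ (z : locAtCentre (blowupRing R x) O) (hz : (z : K) ∈ O),
          constantCoeff (φ₁ z) = ι (IsLocalRing.residue O ⟨z, hz⟩)) ∧
      (∀ (y : R) (_ : y ∈ Ideal.comap (Subring.inclusion hR) (maximalIdeal O))
          (hmem : (y : K) / x ∈ locAtCentre (blowupRing R x) O),
          φ₁ ⟨(y : K) / x, hmem⟩ * (X j * w) = subst (fun s : Fin d => if s = j then
            (X j : MvPowerSeries (Fin d) κ) else X j * (X s + C (ξ s / ξ j))) (φ y)) := by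
  classical
  haveI : IsDomain (MvPowerSeries (Fin d) κ) := NoZeroDivisors.to_isDomain _
  set 𝔠 := Ideal.comap (Subring.inclusion hR) (maximalIdeal O) with h𝔠
  have hmc : maximalIdeal R = 𝔠 := maximalIdeal_eq_centre O hR hdom
  have hxm : (⟨x, hxR⟩ : R) ∈ maximalIdeal R := (hdom _).mpr hxv
  have hx𝔠 : (⟨x, hxR⟩ : R) ∈ 𝔠 := hmc ▸ hxm
  have hdivB : ∀ y : R, y ∈ 𝔠 → (y : K) / x ∈ blowupRing R x :=
    fun y hy => div_mem_blowupRing x (hmc.symm ▸ hy)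
  have hdivO : ∀ y : R, y ∈ 𝔠 → (y : K) / x ∈ O := fun y hy => hB (hdivB y hy)
  -- T2a: the point
  obtain ⟨ξ, hξ⟩ := exists_point O ι hR φ h1 h2 u hu x hdivO
  have hξ' : ∀ (y : R) (hy : y ∈ 𝔠) (hyO : (y : K) / x ∈ O),
      ∑ l, coeff (Finsupp.single l 1) (φ y) * ξ l = ι (IsLocalRing.residue O ⟨(y : K) / x, hyO⟩) :=
    fun y hy hyO => hξ y hy
  have hξx : ∑ l, coeff (Finsupp.single l 1) (φ ⟨x, hxR⟩) * ξ l = 1 := by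
    rw [hξ ⟨x, hxR⟩ hx𝔠]
    have : (⟨(x : K) / x, hdivO ⟨x, hxR⟩ hx𝔠⟩ : O) = 1 := Subtype.ext (div_self hx0)
    rw [this, map_one, map_one]
  -- the chart index
  obtain ⟨j, hj⟩ : ∃ j, ξ j ≠ 0 := by
    by_contra hall
    push Not at hall
    simp only [hall, mul_zero, Finset.sum_const_zero] at hξx
    exact zero_ne_one hξx
  set τ : Fin d → κ := fun s => ξ s / ξ j with hτ
  have hτj : ∀ l, (if l = j then (1 : κ) else τ l) = ξ l / ξ j := by
    intro l
    by_cases h : l = j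
    · rw [if_pos h, h, div_self hj]
    · rw [if_neg h]
  have hs := hasSubst_blowFam j τ
  -- constant coefficient of the strict transforms `W`
  have hW0 : ∀ (G H : MvPowerSeries (Fin d) κ),
      constantCoeff ((∑ l, C (coeff (Finsupp.single l 1) G) *
        (if l = j then (1 : MvPowerSeries (Fin d) κ) else X l + C (τ l))) + X j * H) =
        (∑ l, coeff (Finsupp.single l 1) G * ξ l) / ξ j := by
    intro G H
    rw [map_add, map_mul, constantCoeff_X, zero_mul, add_zero, map_sum, Finset.sum_div]
    refine Finset.sum_congr rfl fun l _ => ?_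
    rw [map_mul, constantCoeff_C, mul_div_assoc, ← hτj l]
    by_cases h : l = j
    · rw [if_pos h, if_pos h, map_one]
    · rw [if_neg h, if_neg h, map_add, constantCoeff_X, constantCoeff_C, zero_add]
  -- the strict transforms of the elements of the centre
  have hWy : ∀ y : R, y ∈ 𝔠 → ∃ W : MvPowerSeries (Fin d) κ,
      subst (fun s : Fin d => if s = j then (X j : MvPowerSeries (Fin d) κ) else X j * (X s + C (τ s))) (φ y)
        = X j * W ∧ constantCoeff W = (∑ l, coeff (Finsupp.single l 1) (φ y) * ξ l) / ξ j := by
    intro y hy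
    obtain ⟨W, H, hW, hWeq⟩ := exists_subst_blowFam_eq_X_mul j τ (φ y)
      (constantCoeff_eq_zero_of_mem_centre O ι hR φ h1 hy)
    exact ⟨W, hW, by rw [hWeq]; exact hW0 _ _⟩
  -- the unit `w`
  obtain ⟨w, hw, hw0⟩ := hWy ⟨x, hxR⟩ hx𝔠
  rw [hξx] at hw0
  have hwu : IsUnit w := by
    rw [MvPowerSeries.isUnit_iff_constantCoeff, hw0]
    exact isUnit_iff_ne_zero.mpr (div_ne_zero one_ne_zero hj)
  -- the map `θ = Φ ∘ φ` and its lift to the chart ring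
  let θ : R →+* MvPowerSeries (Fin d) κ := (substAlgHom hs).toRingHom.comp φ
  have hθ : ∀ r, θ r = subst (fun s : Fin d => if s = j then (X j : MvPowerSeries (Fin d) κ)
      else X j * (X s + C (τ s))) (φ r) := fun r => by
    simp only [θ, RingHom.coe_comp, Function.comp_apply, AlgHom.toRingHom_eq_coe, AlgHom.coe_toRingHom,
      coe_substAlgHom]
  have hXj : (X j : MvPowerSeries (Fin d) κ) ≠ 0 := by
    intro h0
    have := congrArg (coeff (Finsupp.single j 1)) h0
    rw [coeff_X, if_pos rfl, map_zero] at this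
    exact one_ne_zero this
  have hθx : θ ⟨x, hxR⟩ ≠ 0 := by
    rw [hθ, hw]
    exact mul_ne_zero hXj hwu.ne_zero
  have hθdvd : ∀ y ∈ maximalIdeal R, θ ⟨x, hxR⟩ ∣ θ y := by
    intro y hy
    obtain ⟨W, hW, -⟩ := hWy y (hmc ▸ hy)
    obtain ⟨wi, hwi⟩ := hwu.exists_left_inv
    refine ⟨wi * W, ?_⟩
    rw [hθ, hθ, hW, hw]
    calc X j * W = X j * (wi * w) * W := by rw [hwi, mul_one]
      _ = X j * w * (wi * W) := by ring
  obtain ⟨Ψ, hΨR, hΨN⟩ := exists_ringHom_blowupRing hxR hx0 hxm θ hθx hθdvd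
  -- values of `Ψ` on the new generators
  have hΨdiv : ∀ (y : R) (hy : y ∈ 𝔠), Ψ ⟨(y : K) / x, hdivB y hy⟩ * (X j * w) = θ y := by
    intro y hy
    have := hΨN ⟨(y : K) / x, hdivB y hy⟩ 1 y (by rw [pow_one, div_mul_cancel₀ _ hx0])
    rw [pow_one, hθ ⟨x, hxR⟩, hw] at this
    rw [this, mul_comm]
  -- FC1 for `Ψ`
  have hΨ0 : ∀ (z : K) (hz : z ∈ blowupRing R x),
      constantCoeff (Ψ ⟨z, hz⟩) = ι (IsLocalRing.residue O ⟨z, hB hz⟩) := by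
    intro z hz
    induction hz using Subring.closure_induction with
    | mem z hz =>
      rcases hz with hz | ⟨y, hy, rfl⟩
      · have h : Ψ ⟨z, Subring.subset_closure (Or.inl hz)⟩ = θ ⟨z, hz⟩ := hΨR ⟨z, hz⟩
        rw [h, hθ, constantCoeff_subst_blowFam, h1]
        rfl
      · have hy' : y ∈ 𝔠 := hmc ▸ hy
        obtain ⟨W, hW, hWc⟩ := hWy y hy'
        have h := hΨdiv y hy'
        have h' : X j * (Ψ ⟨(y : K) / x, hdivB y hy'⟩ * w) = X j * W := by
          rw [← hW, ← hθ, ← h]; ring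
        have h'' : Ψ ⟨(y : K) / x, hdivB y hy'⟩ * w = W := MvPowerSeries.X_mul_cancel h'
        have hc := congrArg constantCoeff h''
        rw [map_mul, hWc, hw0, hξ y hy'] at hc
        have hc' := congrArg (· * ξ j) hc
        simp only [mul_assoc, div_mul_cancel₀ _ hj, mul_one] at hc'
        exact hc'
    | zero =>
      show constantCoeff (Ψ 0) = ι (IsLocalRing.residue O 0)
      rw [map_zero, map_zero, map_zero, map_zero]
    | one =>
      show constantCoeff (Ψ 1) = ι (IsLocalRing.residue O 1)
      rw [map_one, map_one, map_one, map_one]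
    | add a b ha hb iha ihb =>
      show constantCoeff (Ψ (⟨a, ha⟩ + ⟨b, hb⟩)) =
        ι (IsLocalRing.residue O ((⟨a, hB ha⟩ : O) + ⟨b, hB hb⟩))
      rw [map_add, map_add, map_add, map_add, iha, ihb]
    | neg a ha iha =>
      show constantCoeff (Ψ (-⟨a, ha⟩)) = ι (IsLocalRing.residue O (-(⟨a, hB ha⟩ : O)))
      rw [map_neg, map_neg, map_neg, map_neg, iha]
    | mul a b ha hb iha ihb =>
      show constantCoeff (Ψ (⟨a, ha⟩ * ⟨b, hb⟩)) =
        ι (IsLocalRing.residue O ((⟨a, hB ha⟩ : O) * ⟨b, hB hb⟩))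
      rw [map_mul, map_mul, map_mul, map_mul, iha, ihb]
  -- elements of value `1` go to units
  have hΨu : ∀ b : blowupRing R x, O.valuation (b : K) = 1 → IsUnit (Ψ b) := by
    intro b hb
    rw [MvPowerSeries.isUnit_iff_constantCoeff, hΨ0 b b.2, isUnit_iff_ne_zero, map_ne_zero ι,
      ne_eq, IsLocalRing.residue_eq_zero_iff, ValuationSubring.valuation_lt_one_iff]
    exact fun hlt => lt_irrefl _ (hb ▸ hlt)
  obtain ⟨φ₁, hφ₁B, hφ₁frac⟩ := exists_ringHom_locAtCentre hB Ψ hΨu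
  refine ⟨ξ, j, w, φ₁, hj, hwu, hξ', by rw [hw], fun r hr => ?_, fun z hz => ?_, fun y hy hmem => ?_⟩
  · -- transition law
    have := hφ₁B ⟨r, le_blowupRing R x r.2⟩
    rw [hΨR, hθ] at this
    exact this
  · -- FC1 for `φ₁`
    obtain ⟨y, hy, s, hsB, hvs, hzeq⟩ := mem_locAtCentre_iff.mp z.2
    have hs0 : s ≠ 0 := ne_zero_of_valuation_eq_one hvs
    have hzs : (z : K) * s = y := by rw [hzeq, div_mul_cancel₀ _ hs0]
    have h := hφ₁frac z ⟨y, hy⟩ ⟨s, hsB⟩ hvs hzs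
    have hc := congrArg constantCoeff h
    rw [map_mul, hΨ0 y hy, hΨ0 s hsB] at hc
    -- residues: `res z * res s = res y`
    have hO : (⟨(z : K), hz⟩ : O) * ⟨s, hB hsB⟩ = ⟨y, hB hy⟩ := Subtype.ext hzs
    have hres : ι (IsLocalRing.residue O ⟨(z : K), hz⟩) * ι (IsLocalRing.residue O ⟨s, hB hsB⟩) =
        ι (IsLocalRing.residue O ⟨y, hB hy⟩) := by rw [← map_mul, ← map_mul, hO]
    have hsne : ι (IsLocalRing.residue O ⟨s, hB hsB⟩) ≠ 0 := by
      rw [map_ne_zero ι, ne_eq, IsLocalRing.residue_eq_zero_iff, ValuationSubring.valuation_lt_one_iff]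
      exact fun hlt => lt_irrefl _ (hvs ▸ hlt)
    exact mul_right_cancel₀ hsne (hc.trans hres.symm)
  · -- the new generators
    have := hφ₁B ⟨(y : K) / x, hdivB y hy⟩
    rw [← hθ, ← hΨdiv y hy, ← this]

end Construct

end ChartStep

end Summit.ResolutionOfSingularities.ResolutionOfSingularities.Theorems.SwitchingDichotomy
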